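import Literature.NumberTheory.GaloisCohomology.Howard2004.DVRLevelLiftabilityAtLevelProofs
import Literature.NumberTheory.GaloisCohomology.Howard2004.StubLemmaInductionProofs
import HarnessLib

/-!
# Howard 2004, Lemma 1.6.4 on a `DVRSetting`: the `R`-module data of the induction ENGINE
# (`H¹_{F(n)}(K, T^{(k)})` as an `R`-module, the localisations as `R`-linear maps, `π`-primary torsion)
# and the engine's level-induction with the trivial-stub case (definitions with bodies + theorems)

B. Howard, *The Heegner point Kolyvagin system*, Compositio Math. **140** (2004) (arXiv:1202.6340), Lemma 1.6.4
(arXiv Lemma 2.6.4, p. 11 L82 – p. 12 L27): «fix a generator for the cyclic group `G_ℓ` for every `ℓ` so that we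
may identify `H¹_{F(n)}(K, T^{(k)}) ⊗ G_n ≅ H¹_{F(n)}(K, T^{(k)})`», an `R`-module with its localisations
`loc_ℓ : H¹_{F(n)}(K, T^{(k)}) → H¹(K_ℓ, T^{(k)})` and its stubs `Stub^{(k)}(n) = 𝔪^{λ^{(k)}(n)} H¹_{F(n)}(K,T^{(k)})`.
The cell's ENGINE (`StubLemmaInductionProofs`, seat x10b-p1-w2 g15) is the printed double induction over
ABSTRACT data `H k n`, `loc k n ℓ`, `κ k n`, `Stub k n`, …; this file (L164-DATA, LEAD g12 ruling 2026-08-29) starts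
its INSTANTIATION on a `DVRSetting` `S` with H.0–H.5 (in particular on the full refinement `S.refine` of R6b):

* §1 **`DVRSetting.selmerModuleAt S hy k n`** — `H¹_{F(n)}(K, T^{(k)})` as an `R`-SUBMODULE of `H¹(K, T^{(k)})` for the
  functorial scalar action (`galoisCohomology.moduleH1`; stability = `scalarMapH1_mem_selmerGroup_atLevel`); the
  engine's `H k n` is its coercion to a type;
* §2 **`DVRSetting.locR S k v`** — `loc_v : H¹(K, T^{(k)}) →ₗ[R] H¹(K_v, T^{(k)})` (`localization_scalarMapH1`); the
  engine's `loc k n ℓ` is its restriction to `H k n`;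
* §3 `pow_e_smul_eq_zero` — `π^{e_k} · H¹(K, T^{(k)}) = 0` (the engine's `htors`);
* §4 **`mem_stub_of_stubLemmaInduction_levels'`** — the engine's all-levels theorem with the liftability-case
  input `hlam` weakened to allow the TRIVIAL stub (`λ^{(k)}(n) = 0`, `Stub^{(k)}(n) = H`: then `κ ∈ Stub` is
  immediate — Howard's «divisible by `π^i`» with `i = 0`), which the indexing of a full setting by exponents
  `i + 1 ≥ 1` needs (there is no level of exponent `0`).

Definitions with bodies and theorems only: no named fact, no instance, no notation, no `sorry`.  The Kolyvagin
classes `κ k n` read in `H k n` (PRES + GN-ID), the stubs (which need the levelwise structure Thm. 1.4.2) and the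
discharge of the six Galois hypotheses are NOT here.  `thm161_dvrKolyvaginBound` is NOT proved; BSD is not proved
by any of this.
-/

set_option autoImplicit false

noncomputable section

open Function NumberField IsDedekindDomain Field
open scoped NumberField ContRepresentation Classical

namespace Literature.NumberTheory.GaloisCohomology.Howard2004

open Literature.NumberTheory.GaloisRepresentations
open Literature.NumberTheory.GaloisRepresentations.DiscreteGaloisModule

/-! ## §4 The engine's level induction with the trivial-stub case -/

section Levels

variable {R : Type*} [CommRing R] {ι : Type*} [DecidableEq ι]
  {H : ℕ → Finset ι → Type*} [∀ k n, AddCommGroup (H k n)] [∀ k n, Module R (H k n)]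
  {L : ℕ → Finset ι → ι → Type*} [∀ k n ℓ, AddCommGroup (L k n ℓ)] [∀ k n ℓ, Module R (L k n ℓ)]
  (P : ℕ → Set ι) (ϖ : R) (κ : ∀ k n, H k n) (Stub : ∀ k n, Submodule R (H k n))
  (lam : ℕ → Finset ι → ℕ) (ρp ρm : ℕ → Finset ι → ℕ) (loc : ∀ k n ℓ, H k n →ₗ[R] L k n ℓ)
  (red : ∀ k i n, H k n →ₗ[R] H i n)

omit [DecidableEq ι] in
/-- The liftability case from the lower levels, allowing the trivial stub: if `Stub^{(k)}(n) ≠ 0` then EITHER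
`Stub^{(k)}(n) = H` (Howard's `λ^{(k)}(n) = 0`: «divisible by `π^0`») OR there is a lower level `i = lam k n < k`
with `Stub^{(i)}(n) = 0` and the liftability implication. [cite: Howard2004HeegnerKolyvagin, Lemma 1.6.4 proof, first case (arXiv p. 11 L85 – p. 12 L1)] -/
theorem mem_stub_of_ne_bot_of_lower_levels'
    (hP : ∀ i k, i ≤ k → P k ⊆ P i)
    (hlam : ∀ k n, ↑n ⊆ P k → Stub k n ≠ ⊥ → Stub k n = ⊤ ∨ (lam k n < k ∧ Stub (lam k n) n = ⊥))
    (hred : ∀ k i n, i ≤ k → red k i n (κ k n) = κ i n)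
    (hlift : ∀ k n, ↑n ⊆ P k → Stub k n ≠ ⊥ → Stub k n ≠ ⊤ → red k (lam k n) n (κ k n) = 0 → κ k n ∈ Stub k n)
    (k : ℕ) (ih : ∀ i, i < k → ∀ n, ↑n ⊆ P i → κ i n ∈ Stub i n)
    (n : Finset ι) (hn : ↑n ⊆ P k) (hst : Stub k n ≠ ⊥) : κ k n ∈ Stub k n := by
  rcases hlam k n hn hst with htop | ⟨hi, hbot⟩
  · rw [htop]; exact Submodule.mem_top
  · have hmem : κ (lam k n) n ∈ Stub (lam k n) n := ih _ hi n (fun x hx => hP _ _ hi.le (hn hx))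
    rw [hbot, Submodule.mem_bot] at hmem
    by_cases htop : Stub k n = ⊤
    · rw [htop]; exact Submodule.mem_top
    refine hlift k n hn hst htop ?_
    rw [hred k (lam k n) n hi.le, hmem]

/-- **The engine's all-levels theorem with the trivial-stub case** (`mem_stub_of_stubLemmaInduction_levels` with
`hlam` weakened as in `mem_stub_of_ne_bot_of_lower_levels'`): `κ^{(k)}_n ∈ Stub^{(k)}(n)` for every level `k` and
every `n ∈ 𝓝(P k)`. [cite: Howard2004HeegnerKolyvagin, Lemma 1.6.4 (arXiv Lemma 2.6.4, p. 11 L82 – p. 12 L27)] -/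
theorem mem_stub_of_stubLemmaInduction_levels'
    (hP : ∀ i k, i ≤ k → P k ⊆ P i)
    (hlam : ∀ k n, ↑n ⊆ P k → Stub k n ≠ ⊥ → Stub k n = ⊤ ∨ (lam k n < k ∧ Stub (lam k n) n = ⊥))
    (hred : ∀ k i n, i ≤ k → red k i n (κ k n) = κ i n)
    (hlift : ∀ k n, ↑n ⊆ P k → Stub k n ≠ ⊥ → Stub k n ≠ ⊤ → red k (lam k n) n (κ k n) = 0 → κ k n ∈ Stub k n)
    (hKS : ∀ k n (ℓ : ι), ↑n ⊆ P k → ℓ ∈ P k → ℓ ∉ n →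
      (loc k n ℓ (κ k n) = 0 ↔ loc k (insert ℓ n) ℓ (κ k (insert ℓ n)) = 0))
    (h159 : ∀ k n (ℓ : ι), ↑n ⊆ P k → ℓ ∈ P k → ℓ ∉ n →
      Stub k n ≤ LinearMap.ker (loc k n ℓ) →
        Stub k (insert ℓ n) ≤ LinearMap.ker (loc k (insert ℓ n) ℓ))
    (hsmall : ∀ k n, ↑n ⊆ P k → ρp k n + ρm k n ≤ 1 → Stub k n = ⊤)
    (htors : ∀ k n (x : H k n), ∃ j : ℕ, ϖ ^ j • x = 0)
    (hchebI : ∀ k n, ↑n ⊆ P k → 0 < ρp k n → 0 < ρm k n → ∀ d : H k n, d ≠ 0 → ϖ • d = 0 →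
      ∃ ℓ ∈ P k, ℓ ∉ n ∧ loc k n ℓ d ≠ 0 ∧ ρp k (insert ℓ n) + 1 = ρp k n ∧
        ρm k (insert ℓ n) + 1 = ρm k n)
    (hchebII : ∀ k n, ↑n ⊆ P k → (ρm k n = 0 ∧ 2 ≤ ρp k n) ∨ (ρp k n = 0 ∧ 2 ≤ ρm k n) →
      ∀ d : H k n, d ≠ 0 → ϖ • d = 0 →
      ∃ ℓ ∈ P k, ℓ ∉ n ∧ loc k n ℓ d ≠ 0 ∧ 0 < ρp k (insert ℓ n) ∧ 0 < ρm k (insert ℓ n) ∧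
        ρp k (insert ℓ n) + ρm k (insert ℓ n) = ρp k n + ρm k n)
    (k : ℕ) (n : Finset ι) (hn : ↑n ⊆ P k) : κ k n ∈ Stub k n := by
  induction k using Nat.strong_induction_on generalizing n with
  | _ k ih =>
    exact mem_stub_of_stubLemmaInduction (P k) ϖ (κ k) (Stub k) (ρp k) (ρm k) (loc k) (hKS k)
      (h159 k) (hsmall k)
      (mem_stub_of_ne_bot_of_lower_levels' P κ Stub lam red hP hlam hred hlift k ih)
      (htors k) (hchebI k) (hchebII k) n hn

end Levels

/-! ## §1–§3 The `R`-module data on a `DVRSetting` -/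

namespace DVRSetting

variable {p : ℕ} [Fact p.Prime] {K : Type} [Field K] [NumberField K]
  {R : Type} [CommRing R] [IsDomain R] [IsDiscreteValuationRing R] [Algebra ℤ_[p] R]
  {N : ℕ → Type} [∀ k, AddCommGroup (N k)] [∀ k, TopologicalSpace (N k)]
  [∀ k, DiscreteTopology (N k)] [∀ k, Module R (N k)]
  {Rk : ℕ → Type} [∀ k, CommRing (Rk k)] [∀ k, IsLocalRing (Rk k)] [∀ k, TopologicalSpace (Rk k)]
  [∀ k, DiscreteTopology (Rk k)] [∀ k, Algebra ℤ_[p] (Rk k)] [∀ k, Algebra R (Rk k)]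
  [∀ k, Module (Rk k) (N k)] [∀ k, IsScalarTower R (Rk k) (N k)]
  {Nbar : Type} [AddCommGroup Nbar] [TopologicalSpace Nbar] [DiscreteTopology Nbar]
  [∀ k, Module (Rk k) Nbar]
  {Nq : ℕ → Finset (HeightOneSpectrum (𝓞 K)) → Type} [∀ k n, AddCommGroup (Nq k n)]
  [∀ k n, TopologicalSpace (Nq k n)] [∀ k n, DiscreteTopology (Nq k n)]
  [∀ k n, Module (Rk k) (Nq k n)] [∀ k n, Module R (Nq k n)]
  [∀ k n, IsScalarTower R (Rk k) (Nq k n)]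

/-- **`H¹_{F(n)}(K, T^{(k)})` as an `R`-submodule of `H¹(K, T^{(k)})`** for the functorial scalar action
(`galoisCohomology.moduleH1`, to be bound with `letI`): the Selmer group of the modified structure `F(n)`
(`SelmerTriple.atLevel`, transverse at the primes of `n`), stable under the action (`scalarMapH1_mem_selmerGroup_atLevel`).
The engine's `H k n`. [cite: Howard2004HeegnerKolyvagin, Def. 1.1.1, Def. 1.2.2 and Lemma 1.6.4 (arXiv p. 5 L20–21, p. 6 L101–125, p. 11 L88–90)] -/
def selmerModuleAt (S : DVRSetting p K R N Rk Nbar Nq) (hy : S.SatisfiesH) (k : ℕ)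
    (n : Finset (HeightOneSpectrum (𝓞 K))) :
    letI := galoisCohomology.moduleH1 (S.T.ρ k) (S.T.hlin k)
    Submodule R (galoisCohomology (S.T.ρ k) 1) :=
  galoisCohomology.submoduleOfStable (S.T.hlin k) (((S.t k).atLevel S.jbar n).cond).selmerGroup
    (fun r _ hx => S.scalarMapH1_mem_selmerGroup_atLevel hy k n r hx)

/-- Membership in `selmerModuleAt` is membership in the Selmer group `H¹_{F(n)}(K, T^{(k)})`.
[cite: Howard2004HeegnerKolyvagin, Def. 1.1.10 and Def. 1.2.2 (arXiv p. 6 L14–24, L101–125)] -/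
@[simp] theorem mem_selmerModuleAt_iff (S : DVRSetting p K R N Rk Nbar Nq) (hy : S.SatisfiesH) (k : ℕ)
    (n : Finset (HeightOneSpectrum (𝓞 K))) (x : galoisCohomology (S.T.ρ k) 1) :
    letI := galoisCohomology.moduleH1 (S.T.ρ k) (S.T.hlin k)
    x ∈ S.selmerModuleAt hy k n ↔ x ∈ (((S.t k).atLevel S.jbar n).cond).selmerGroup :=
  Iff.rfl

/-- **`loc_v : H¹(K, T^{(k)}) →ₗ[R] H¹(K_v, T^{(k)})`** — the localisation at a place as an `R`-LINEAR map for the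
functorial scalar actions (`localization_scalarMapH1`).  The engine's `loc k n ℓ` is its restriction to
`H¹_{F(n)}(K, T^{(k)})` at `v = ℓ`. [cite: Howard2004HeegnerKolyvagin, Lemma 1.6.4 (arXiv p. 12 L5–21: `loc_ℓ`)] -/
def locR (S : DVRSetting p K R N Rk Nbar Nq) (k : ℕ) (v : Place K) :
    letI := galoisCohomology.moduleH1 (S.T.ρ k) (S.T.hlin k)
    letI := galoisCohomology.moduleH1 ((S.T.ρ k).toLocal v) ((S.T.hlin k).restrictField (Place.Completion v))
    galoisCohomology (S.T.ρ k) 1 →ₗ[R] galoisCohomology ((S.T.ρ k).toLocal v) 1 :=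
  letI := galoisCohomology.moduleH1 (S.T.ρ k) (S.T.hlin k)
  letI := galoisCohomology.moduleH1 ((S.T.ρ k).toLocal v) ((S.T.hlin k).restrictField (Place.Completion v))
  { toFun := galoisCohomology.localization (S.T.ρ k) v 1
    map_add' := fun x y => map_add _ x y
    map_smul' := fun r x => by
      rw [RingHom.id_apply, galoisCohomology.smul_def, galoisCohomology.smul_def]
      exact galoisCohomology.localization_scalarMapH1 (S.T.hlin k) v r x }

/-- Unfolding `locR`: it is the localisation map. [cite: Howard2004HeegnerKolyvagin, Lemma 1.6.4 (arXiv p. 12 L5–21)] -/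
@[simp] theorem locR_apply (S : DVRSetting p K R N Rk Nbar Nq) (k : ℕ) (v : Place K)
    (x : galoisCohomology (S.T.ρ k) 1) :
    S.locR k v x = galoisCohomology.localization (S.T.ρ k) v 1 x := rfl

/-- **`π^{e_k}` kills `H¹(K, T^{(k)})`** (it kills `T^{(k)}`): the classes are `π`-primary torsion — the engine's
`htors`. [cite: Howard2004HeegnerKolyvagin, §1.6 (arXiv p. 11 L33–36: `T^{(k)} = T/𝔪^kT`)] -/
theorem pow_e_smul_eq_zero (S : DVRSetting p K R N Rk Nbar Nq) (hy : S.SatisfiesH) (k : ℕ)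
    (x : galoisCohomology (S.T.ρ k) 1) :
    letI := galoisCohomology.moduleH1 (S.T.ρ k) (S.T.hlin k)
    S.π ^ S.e k • x = 0 := by
  have hπ : S.π ∈ IsLocalRing.maximalIdeal R := by rw [hy.unif]; exact Ideal.mem_span_singleton_self _
  exact galoisCohomology.smul_eq_zero_of_forall (S.T.ρ k) (S.T.hlin k) (S.π ^ S.e k)
    (fun m => hy.killed k _ (Ideal.pow_mem_pow hπ _) m) x

/-- The engine's `htors` on `H¹_{F(n)}(K, T^{(k)})`: every class is killed by a power of `π`.
[cite: Howard2004HeegnerKolyvagin, Lemma 1.6.4 proof (arXiv p. 12 L2–3)] -/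
theorem exists_pow_smul_eq_zero_selmerModuleAt (S : DVRSetting p K R N Rk Nbar Nq) (hy : S.SatisfiesH) (k : ℕ)
    (n : Finset (HeightOneSpectrum (𝓞 K))) :
    letI := galoisCohomology.moduleH1 (S.T.ρ k) (S.T.hlin k)
    ∀ x : S.selmerModuleAt hy k n, ∃ j : ℕ, S.π ^ j • x = 0 := by
  letI := galoisCohomology.moduleH1 (S.T.ρ k) (S.T.hlin k)
  intro x
  exact ⟨S.e k, Subtype.ext (S.pow_e_smul_eq_zero hy k (x : galoisCohomology (S.T.ρ k) 1))⟩

end DVRSetting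

end Literature.NumberTheory.GaloisCohomology.Howard2004

end
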